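import Summits.Ventures.DiscreteObjects.PP12.FlagTenOrbitDataOfPlane
import Summits.Ventures.DiscreteObjects.PP12.OrbitSideIdentities

/-!
# The `f = 10` flag-cell orbit data: `C` separates a triangle from the triangle it is inscribed in (kernel; Step C, conjunct 3 second half)
Framing: lottery ticket; floor = certified bounds/negative ranges.

Cell pub-namedobj (venture DiscreteObjects), target (M), designs gen 13 (HOME FAMILY-FLAG7X §7/§7b). Setting as in `FlagTenOrbitDataOfPlane`.
* `orb3_side_noFixed` — the lines of the orbit of a line without fixed points carry no fixed point;
* `foreignSide_mem_orb3_side` — the foreign side of `x` lies in the side orbit of the triangle of `phiVertex x`;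
* **`cOrb_phiVertex_ne`** — for every fixed point `y ≠ c`, `cOrb y (phiVertex x) ≠ cOrb y x`: the (C1) identity
  `OrbitSideIdentities.vertex_vertex_identity` for the vertices `x` and `phiVertex x`, in which the inscription term and the c-line `u₀` already
  account for the right-hand side `3`, so no T-line orbit through `x` reaches `phiVertex x`.
With `FlagTenFibres.card_cOrb_fibre` this is conjunct 3 (`IsTriangleColouring φ (C k)`) of `IsFlagTenOrbitMatrix` before transport.
No `sorry`, no new axioms.
-/

namespace Summit.Ventures.DiscreteObjects.PP12

open Configuration Finset
open scoped Classical

namespace Collineation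

variable {P L : Type*} [Membership P L] [ProjectivePlane P L] [Fintype P] [Fintype L] (σ : Collineation P L)

omit [ProjectivePlane P L] [Fintype P] [Fintype L] in
/-- The lines of the orbit of a line without fixed points carry no fixed point (`σ³ = 1` not needed: images of a fixed point are fixed). -/
theorem orb3_side_noFixed {a : L} (ha0 : ∀ p : P, σ.onPoints p = p → p ∉ a) {g : L} (hg : g ∈ orb3 σ.onLines a) :
    ∀ p : P, σ.onPoints p = p → p ∉ g := by
  intro p hp hpg
  have back : ∀ k : L, p ∈ σ.onLines k → p ∈ k := fun k h => (σ.mem_iff p k).1 (by rw [hp]; exact h)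
  rw [mem_orb3] at hg
  rcases hg with rfl | rfl | rfl
  · exact ha0 p hp hpg
  · exact ha0 p hp (back a hpg)
  · exact ha0 p hp (back a (back _ hpg))

section Flag

variable {l : L} {c : P} (hl : σ.onLines l = l) (hc : σ.onPoints c = c) (hcl : c ∈ l)
  (hP : ∀ p : P, σ.onPoints p = p → p ∈ l) (hL : ∀ m : L, σ.onLines m = m → c ∈ m)
  (h12 : ProjectivePlane.order P L = 12)

omit [Fintype P] [Fintype L] in
/-- A line through two consecutive points `Q, σQ` of the orbit of `x'` lies in the orbit of the side `x'·σx'` (`σ³ = 1`). -/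
theorem mem_orb3_sideOf_of_side (hq : σ.onPoints ^ 3 = 1) {x' : P} (hx'f : σ.onPoints x' ≠ x') {Q : P} (hQx' : Q ∈ orb3 σ.onPoints x')
    (hQf : σ.onPoints Q ≠ Q) {F : L} (hQF : Q ∈ F) (hσQF : σ.onPoints Q ∈ F) : F ∈ orb3 σ.onLines (σ.sideOf l x') := by
  obtain ⟨hx'a', hσx'a'⟩ := σ.sideOf_spec l hx'f
  have h3 := apply_three σ.onPoints hq x'
  have hQσQ : Q ≠ σ.onPoints Q := fun e => hQf e.symm
  have uniq : ∀ k : L, Q ∈ k → σ.onPoints Q ∈ k → F = k := fun k h1 h2 =>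
    (Nondegenerate.eq_or_eq hQF hσQF h1 h2).resolve_left hQσQ
  rw [mem_orb3] at hQx' ⊢
  rcases hQx' with e | e | e
  · left; apply uniq <;> rw [e]
    · exact hx'a'
    · exact hσx'a'
  · right; left; apply uniq <;> rw [e]
    · exact σ.mem_map hx'a'
    · exact σ.mem_map hσx'a'
  · right; right; apply uniq <;> rw [e]
    · exact σ.mem_map (σ.mem_map hx'a')
    · exact σ.mem_map (σ.mem_map hσx'a')

include hl hc hcl hP hL h12 in
/-- **`C` separates a triangle from the triangle it is inscribed in** (`f = 10`): for a fixed point `y ≠ c`, the line orbits of `x·y` and of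
`(phiVertex x)·y` are different. -/
theorem cOrb_phiVertex_ne (hq : σ.onPoints ^ 3 = 1) (hf : fixedCard σ.onPoints = 10) {u₀ : L} (hcu₀ : c ∈ u₀) (hu₀ : σ.onLines u₀ ≠ u₀)
    {x : P} (hxu : x ∈ u₀) (hxc : x ≠ c) {y : P} (hy : σ.onPoints y = y) (hyc : y ≠ c) :
    σ.cOrb l y (σ.phiVertex l c u₀ x) ≠ σ.cOrb l y x := by
  intro hC
  have hqL : σ.onLines ^ 3 = 1 := σ.onLines_pow_eq_one hq
  have hxX := σ.exterior_of_mem_cline hL hcu₀ hu₀ hxu hxc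
  have hxf : σ.onPoints x ≠ x := σ.not_fixed_of_exterior_flag hl hP hxX
  obtain ⟨hxa, hσxa⟩ := σ.sideOf_spec l hxf
  obtain ⟨-, ha0⟩ := σ.side_no_fixed_point hxf hxX hxa hσxa
  obtain ⟨hx'u, hx'c, ⟨Q, hQx', hQF, hσQF⟩, hne⟩ := σ.phiVertex_spec hl hc hcl hP hL h12 hq hf hcu₀ hu₀ hxX
  set x' := σ.phiVertex l c u₀ x with hx'_def
  obtain ⟨hxF, hF0, -, -⟩ := σ.foreignSide_spec hl hP h12 hq hf hxX
  set F := σ.foreignSide l x with hF_def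
  have hx'X := σ.exterior_of_mem_cline hL hcu₀ hu₀ hx'u hx'c
  have hx'f : σ.onPoints x' ≠ x' := σ.not_fixed_of_exterior_flag hl hP hx'X
  obtain ⟨hx'a', hσx'a'⟩ := σ.sideOf_spec l hx'f
  obtain ⟨-, ha0'⟩ := σ.side_no_fixed_point hx'f hx'X hx'a' hσx'a'
  have hQX : ∀ m' : L, σ.onLines m' = m' → Q ∉ m' := σ.exterior_of_mem_orb3 hx'X hQx'
  have hQf : σ.onPoints Q ≠ Q := σ.not_fixed_of_exterior_flag hl hP hQX
  have hFo : F ∈ orb3 σ.onLines (σ.sideOf l x') := σ.mem_orb3_sideOf_of_side hq hx'f hQx' hQf hQF hσQF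
  -- the two vertex/side-orbit pairs: e = σ²(x·σx) ∋ x with σe ∋ x, and e' likewise for x'
  have h3 := apply_three σ.onPoints hq
  have h3L := apply_three σ.onLines hqL
  set e : L := σ.onLines (σ.onLines (σ.sideOf l x)) with he_def
  set e' : L := σ.onLines (σ.onLines (σ.sideOf l x')) with he'_def
  have hxe : x ∈ e := by have := σ.mem_map (σ.mem_map hσxa); rw [h3] at this; exact this
  have hxσe : x ∈ σ.onLines e := by rw [he_def, h3L]; exact hxa
  have hx'e' : x' ∈ e' := by have := σ.mem_map (σ.mem_map hσx'a'); rw [h3] at this; exact this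
  have hx'σe' : x' ∈ σ.onLines e' := by rw [he'_def, h3L]; exact hx'a'
  have heo : orb3 σ.onLines e = orb3 σ.onLines (σ.sideOf l x) :=
    orb3_eq_of_mem σ.onLines hqL ((mem_orb3 _ _ _).2 (Or.inr (Or.inr rfl)))
  have he'o : orb3 σ.onLines e' = orb3 σ.onLines (σ.sideOf l x') :=
    orb3_eq_of_mem σ.onLines hqL ((mem_orb3 _ _ _).2 (Or.inr (Or.inr rfl)))
  have hne_e : σ.onLines e ≠ e := by
    intro h'; exact (σ.orb3_side_noFixed ha0 ((mem_orb3 _ _ _).2 (Or.inr (Or.inr rfl)))) c hc (hL e h')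
  have hne_e' : σ.onLines e' ≠ e' := by
    intro h'; exact (σ.orb3_side_noFixed ha0' ((mem_orb3 _ _ _).2 (Or.inr (Or.inr rfl)))) c hc (hL e' h')
  -- the orbits of e and e' differ: a common line would be a side of both triangles
  have hee' : orb3 σ.onLines e ≠ orb3 σ.onLines e' := by
    intro h'
    -- F ∈ orb3 (sideOf x') = orb3 e' = orb3 e = orb3 (sideOf x): F is a side of the triangle of x through ... containing x: impossible
    have hFx : F ∈ orb3 σ.onLines (σ.sideOf l x) := by rw [← heo, h', he'o]; exact hFo
    -- every line of orb3 (sideOf x) carries two consecutive points of orb3 x; with x ∈ F this makes F an own side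
    rw [mem_orb3] at hFx
    obtain ⟨-, -, h1, h2⟩ := σ.foreignSide_spec hl hP h12 hq hf hxX
    rcases hFx with eF | eF | eF
    · exact h1 (by rw [hF_def.symm.trans eF] ; exact hσxa)
    · -- F = σ(sideOf x) ∋ σx
      exact h1 (by rw [hF_def.symm.trans eF]; exact σ.mem_map hxa)
    · -- F = σ²(sideOf x) ∋ σ²x
      exact h2 (by rw [hF_def.symm.trans eF]; exact σ.mem_map (σ.mem_map hxa))
  have hx0 : ∀ g : L, x ∈ g → σ.onLines g ≠ g := fun g hxg hg => hxX g hg hxg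
  have hid := σ.vertex_vertex_identity hq hne_e hne_e' hee' hxf hxe hxσe hx0 hx'f hx'e' hx'σe'
  -- second term ≥ 1: F ∈ orb3 e' passes through x
  have hB : 1 ≤ ((orb3 σ.onLines e').filter fun g => x ∈ g).card :=
    card_pos.2 ⟨F, mem_filter.2 ⟨by rw [he'o]; exact hFo, hxF⟩⟩
  -- third term ≥ 1: the c-line u₀ through x and x'
  set R : Finset L := univ.filter fun g : L => x ∈ g ∧ g ∉ orb3 σ.onLines e ∧ g ∉ orb3 σ.onLines e' ∧
      ∃ g' ∈ orb3 σ.onLines g, x' ∈ g' with hR_def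
  have notside : ∀ {g : L}, c ∈ g ∨ y ∈ g → g ∉ orb3 σ.onLines e ∧ g ∉ orb3 σ.onLines e' := by
    intro g hg
    constructor
    · intro h'; rw [heo] at h'
      rcases hg with hg | hg
      · exact σ.orb3_side_noFixed ha0 h' c hc hg
      · exact σ.orb3_side_noFixed ha0 h' y hy hg
    · intro h'; rw [he'o] at h'
      rcases hg with hg | hg
      · exact σ.orb3_side_noFixed ha0' h' c hc hg
      · exact σ.orb3_side_noFixed ha0' h' y hy hg
  have hu₀R : u₀ ∈ R := by
    rw [hR_def, mem_filter]
    exact ⟨mem_univ _, hxu, (notside (Or.inl hcu₀)).1, (notside (Or.inl hcu₀)).2, u₀, self_mem_orb3 _ _, hx'u⟩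
  have hR1 : 1 ≤ R.card := card_pos.2 ⟨u₀, hu₀R⟩
  have hRle : R.card ≤ 1 := by omega
  have hReq : R = {u₀} := Finset.eq_singleton_iff_unique_mem.2 ⟨hu₀R, fun g hg => Finset.card_le_one.1 hRle g hg u₀ hu₀R⟩
  -- the T-line x·y would also be in R if the two C-orbits agreed
  obtain ⟨-, hxk, hyk⟩ := σ.cOrb_mem hl hP hxX hy
  obtain ⟨-, hx'k', hyk'⟩ := σ.cOrb_mem hl hP hx'X hy
  have hkR : lineThrough l x y ∈ R := by
    rw [hR_def, mem_filter]
    refine ⟨mem_univ _, hxk, (notside (Or.inr hyk)).1, (notside (Or.inr hyk)).2, lineThrough l x' y, ?_, hx'k'⟩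
    change orb3 σ.onLines (lineThrough l x' y) = orb3 σ.onLines (lineThrough l x y) at hC
    rw [← hC]; exact self_mem_orb3 _ _
  rw [hReq, mem_singleton] at hkR
  -- so u₀ = x·y ∋ y: then u₀ ∋ y, c is the line l, which is fixed
  have hyu : y ∈ u₀ := by rw [← hkR]; exact hyk
  exact hu₀ (((Nondegenerate.eq_or_eq hyu hcu₀ (hP y hy) hcl).resolve_left hyc) ▸ hl)

end Flag

end Collineation

end Summit.Ventures.DiscreteObjects.PP12
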